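import Summits.RiemannHypothesis.RiemannHypothesis.Theses.SignCone
import Summits.RiemannHypothesis.RiemannHypothesis.Theorems.SignConeUnitSlackReduction
import Summits.RiemannHypothesis.RiemannHypothesis.Theorems.SignConeOscCoherentCoreStubTransfer
import Summits.RiemannHypothesis.RiemannHypothesis.Theorems.SignConeOscCoherentCoreStubRHOfOffLineMoment

/-!
# `SignCone.OscCoherentCore` reduced to the windowed off-line second-moment law
(route `SignCone`, item stmt-RiemannHypothesis-18013, line `Sketch`; `--supports`)

The sorry-free part of the line's skeleton (`Cruxes/OscCoherentCore/Lines/Sketch.lean`), typed against the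
ROUTE DECLARATION `OscCoherentCore`:

* `signConeAt_of_offLineMomentAt` — PER-CUTOFF TRANSFER: at a fixed cutoff `a ≥ 1`, the windowed off-line
  second-moment law for the zeros of `ζ` with constant `κ(a) = 1/(400 (2a+1)³ cosh(a+1/2) (a+1))` implies the
  unit-slack sign-cone inequality `-Re F(0) ≤ Re W_ar(F)` for every node-nonnegative `F = Σᵢ gᵢ ⋆ g̃ᵢ` with
  `tsupport gᵢ ⊆ [-a, a]` (the body of the route items at that cutoff; no oscillation / window hypothesis is
  needed). This is the line's unconditional content: a polynomial-in-`e^{a}` dictionary between the cutoff and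
  zero statistics, replacing the triple-exponential tower of effective magnification (W-EFFMAG, 2001).
* `oscCoherentCore_of_offLineMoment` — hence the law at every cutoff `a > 13/10` implies the crux
  `OscCoherentCore` (the skeleton's `OscCoherentCore_of` is this applied to the terminal stub).
* `offLineMoment_of_riemannHypothesis` — RH implies the law at every cutoff with every constant `κ ≥ 0`
  (vacuously: every indexed zero is on the line);
* `offLineMoment_iff_riemannHypothesis` — over all cutoffs `a > 13/10` the law is EQUIVALENT to RH
  (`stub_riemannHypothesis_of_offLineMoment`): the terminal stub of the line is honestly RH-strength;
(The RH-sandwich `RH → OscCoherentCore` is already landed as `SignCone.oscCoherentCore_of_riemannHypothesis`,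
`Theorems/SignConeSignConeOscillatoryCoherentCoreCollapse.lean`; through this line it is
`oscCoherentCore_of_offLineMoment (offLineMoment_iff_riemannHypothesis.2 hRH)`.)
-/

noncomputable section

-- `Summit.RiemannHypothesis.RiemannHypothesis.…` repeats a namespace component by design (D-0017 layout).
set_option linter.dupNamespace false

open scoped BigOperators ComplexConjugate Real
open Complex MeasureTheory Set Filter

namespace Summit.RiemannHypothesis.RiemannHypothesis.Theorems.OscCoherentCore

open Literature.NumberTheory.LFunctions
open Summit.RiemannHypothesis.RiemannHypothesis.Theorems.SignCone
open Summit.RiemannHypothesis.RiemannHypothesis.Theses.SignCone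

/-- **Per-cutoff transfer.** At a fixed cutoff `a ≥ 1`: if every height window `|Im ρ - t| ≤ 1/a` carries
multiplicity-weighted off-line depth `Σ m(ρ)(Re ρ - 1/2)² ≤ κ(a) = 1/(400 (2a+1)³ cosh(a+1/2) (a+1))` (zeros of `ζ`
with `0 ≤ Re ρ ≤ 1`, `Im ρ ≠ 0`), then `-Re F(0) ≤ Re W_ar(F)` for every node-nonnegative autocorrelation sum
`F = Σᵢ gᵢ ⋆ g̃ᵢ` of Weil tests supported in `[-a, a]` — the body of the route's sign-cone items at cutoff `a`, over
Mathlib primitives. Proof: `stub_transfer` (unit-slack Weil positivity at cutoff `a`) and the landed unit-slack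
reduction with the true prime weight `c = Λ` (node signs enter once, through `P_Λ(F) ≥ 0`). [folklore] -/
theorem signConeAt_of_offLineMomentAt {a : ℝ} (ha : 1 ≤ a)
    (hlaw : ∀ (t : ℝ) (S : Finset ℂ),
      (∀ ρ ∈ S, riemannZeta ρ = 0 ∧ 0 ≤ ρ.re ∧ ρ.re ≤ 1 ∧ ρ.im ≠ 0 ∧ |ρ.im - t| ≤ 1 / a) →
      ∑ ρ ∈ S, (riemannZetaZeroOrder ρ : ℝ) * (ρ.re - 1 / 2) ^ 2 ≤
        1 / (400 * (2 * a + 1) ^ 3 * Real.cosh (a + 1 / 2) * (a + 1))) :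
    ∀ (k : ℕ) (g : Fin k → ℝ → ℂ), (∀ i, (ContDiff ℝ ((⊤ : ℕ∞) : WithTop ℕ∞) (g i) ∧ HasCompactSupport (g i)) ∧ tsupport (g i) ⊆ Set.Icc (-a) a) → let F : ℝ → ℂ := fun t => ∑ i, MeasureTheory.convolution (g i) (fun u => (starRingEnd ℂ) ((g i) (-u))) (ContinuousLinearMap.mul ℂ ℂ) MeasureTheory.MeasureSpace.volume t; (∀ n : ℕ, 2 ≤ n → 0 ≤ (F (Real.log n)).re) → let M : ℂ → ℂ := fun s => ∫ u : ℝ, F u * Complex.exp ((s - 1 / 2) * u); -(F 0).re ≤ (M 0 + M 1 + ((1 / (2 * Real.pi) : ℂ) * (∫ t : ℝ, M (1 / 2 + t * Complex.I) * ((Complex.digamma (1 / 4 + t / 2 * Complex.I)).re : ℂ)) - F 0 * (Real.log Real.pi : ℂ))).re := by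
  intro k g hg F hn M
  show -(F 0).re ≤ (weilPolarTerm F + weilArchTerm F).re
  have hW := stub_transfer a ha hlaw
  refine neg_re_apply_zero_le_re_weilArchPolar_of_fakeWeight_unitSlack (b := a)
    (c := fun n => ArithmeticFunction.vonMangoldt n) (fun _ => ArithmeticFunction.vonMangoldt_nonneg)
    (fun g' hg' hs' => ?_) (g := g) (F := F) rfl (fun i => (hg i).1) (fun i => (hg i).2) hn
  have e : weilPolarTerm (weilConv g' (weilReflect g')) + weilArchTerm (weilConv g' (weilReflect g')) -
      ∑' n : ℕ, ((ArithmeticFunction.vonMangoldt n : ℝ) : ℂ) / (Real.sqrt n : ℂ) *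
        (weilConv g' (weilReflect g') (Real.log n) + weilConv g' (weilReflect g') (-Real.log n)) =
      weilQuadratic g' := by
    unfold weilQuadratic weilFunctional weilPrimeTerm
    ring
  rw [e]
  exact hW g' hg' hs'

/-- **The crux reduced to the terminal stub.** If the windowed off-line second-moment law holds at every cutoff
`a > 13/10` (with constant `κ(a)`), then `OscCoherentCore`. The item's oscillation and not-a-single-window
hypotheses are not used (they carry no content: `Theorems/SignConeSignConeOscillatoryCoherentCoreCollapse`).
[folklore] -/
theorem oscCoherentCore_of_offLineMoment
    (hlaw : ∀ a : ℝ, 13 / 10 < a → ∀ (t : ℝ) (S : Finset ℂ),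
      (∀ ρ ∈ S, riemannZeta ρ = 0 ∧ 0 ≤ ρ.re ∧ ρ.re ≤ 1 ∧ ρ.im ≠ 0 ∧ |ρ.im - t| ≤ 1 / a) →
      ∑ ρ ∈ S, (riemannZetaZeroOrder ρ : ℝ) * (ρ.re - 1 / 2) ^ 2 ≤
        1 / (400 * (2 * a + 1) ^ 3 * Real.cosh (a + 1 / 2) * (a + 1))) :
    OscCoherentCore := by
  intro a ha ha' k g hg F hn _hwin _hosc
  exact signConeAt_of_offLineMomentAt (by linarith) (hlaw a ha') k g hg hn

/-- STUB (registered composition stub `stub_cruxOfOffLineMoment`, uncurried form of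
`oscCoherentCore_of_offLineMoment`): the windowed off-line second-moment law at every cutoff `a > 13/10` implies
the crux `OscCoherentCore`. [folklore] -/
theorem stub_cruxOfOffLineMoment :
    (∀ a : ℝ, 13 / 10 < a → ∀ (t : ℝ) (S : Finset ℂ),
      (∀ ρ ∈ S, riemannZeta ρ = 0 ∧ 0 ≤ ρ.re ∧ ρ.re ≤ 1 ∧ ρ.im ≠ 0 ∧ |ρ.im - t| ≤ 1 / a) →
      ∑ ρ ∈ S, (riemannZetaZeroOrder ρ : ℝ) * (ρ.re - 1 / 2) ^ 2 ≤
        1 / (400 * (2 * a + 1) ^ 3 * Real.cosh (a + 1 / 2) * (a + 1))) →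
    Summit.RiemannHypothesis.RiemannHypothesis.Theses.SignCone.OscCoherentCore :=
  fun h => oscCoherentCore_of_offLineMoment h

/-- Under RH the windowed off-line second-moment law holds at every cutoff with every non-negative constant:
each indexed zero has `Im ρ ≠ 0`, hence is non-trivial and `≠ 1`, so `Re ρ = 1/2` and its term vanishes.
[folklore] -/
theorem offLineMoment_of_riemannHypothesis (hRH : RiemannHypothesis) {a κ : ℝ} (hκ : 0 ≤ κ) :
    ∀ (t : ℝ) (S : Finset ℂ),
      (∀ ρ ∈ S, riemannZeta ρ = 0 ∧ 0 ≤ ρ.re ∧ ρ.re ≤ 1 ∧ ρ.im ≠ 0 ∧ |ρ.im - t| ≤ 1 / a) →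
      ∑ ρ ∈ S, (riemannZetaZeroOrder ρ : ℝ) * (ρ.re - 1 / 2) ^ 2 ≤ κ := by
  intro t S hS
  have hS0 : ∀ ρ ∈ S, (riemannZetaZeroOrder ρ : ℝ) * (ρ.re - 1 / 2) ^ 2 = 0 := by
    intro ρ hρ
    obtain ⟨hz, -, -, him, -⟩ := hS ρ hρ
    have hne : ρ ≠ 1 := by
      rintro rfl
      simp at him
    have hre : ρ.re = 1 / 2 := by
      refine hRH ρ hz ?_ hne
      rintro ⟨n, rfl⟩
      simp at him
    rw [hre, sub_self]
    ring
  rw [Finset.sum_eq_zero hS0]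
  exact hκ

/-- **The terminal stub of the line is RH-equivalent** (over all cutoffs `a > 13/10`): honest label, kernel-checked.
`→` is `stub_riemannHypothesis_of_offLineMoment`; `←` is `offLineMoment_of_riemannHypothesis` with `κ = κ(a) ≥ 0`.
[folklore] -/
theorem offLineMoment_iff_riemannHypothesis :
    (∀ a : ℝ, 13 / 10 < a → ∀ (t : ℝ) (S : Finset ℂ),
      (∀ ρ ∈ S, riemannZeta ρ = 0 ∧ 0 ≤ ρ.re ∧ ρ.re ≤ 1 ∧ ρ.im ≠ 0 ∧ |ρ.im - t| ≤ 1 / a) →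
      ∑ ρ ∈ S, (riemannZetaZeroOrder ρ : ℝ) * (ρ.re - 1 / 2) ^ 2 ≤
        1 / (400 * (2 * a + 1) ^ 3 * Real.cosh (a + 1 / 2) * (a + 1))) ↔ RiemannHypothesis := by
  refine ⟨fun h => stub_riemannHypothesis_of_offLineMoment h, fun hRH a ha => ?_⟩
  have hκ : (0 : ℝ) ≤ 1 / (400 * (2 * a + 1) ^ 3 * Real.cosh (a + 1 / 2) * (a + 1)) := by
    have : 0 < Real.cosh (a + 1 / 2) := Real.cosh_pos _
    have : 0 < a := by linarith
    positivity
  exact offLineMoment_of_riemannHypothesis hRH hκ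

end Summit.RiemannHypothesis.RiemannHypothesis.Theorems.OscCoherentCore

end
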